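import Summits.Ventures.AbcSig.Rows.XTemplateC2a
import Summits.Ventures.AbcSig.Rows.C2aL359A0

/-!
# Venture AbcSig — ROW `C2aL359A0AB`: `359^m·xⁿ + yⁿ = z²` (second distribution, by symmetry), class `a = 0`, over the level files 11488 (norm-form certificates) and 718 (ordinary tree certificates) (GENERATED by p-lean g4 `gen4/c2arow2.py`)

HONEST FRAMING. A row of a COMPUTATION cell (`pub-abcsig`); a CONDITIONAL theorem, no claim on ABC or any summit.
Hypotheses: `BS04Package` (CITED: [BS04] Lemma 3.3 + (3.1) + Lemma 4.2); `DataComplete` at both levels and `RefinesCPSymAll` at the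
norm-form level(s) (COMPUTED: certified engine-1 level files; `Sieve/CharpolyCert.lean` / `Sieve/CharpolyTwist.lean`);
and the listed per-orbit exclusions `hX_…` (CITED: the row of record's module closures — M4 Kraus / M6 / M8 / [BS04, Prop 4.4/4.6] as its R3
names them; nothing of those is checked here). Exponent range: prime `n ≥ 11`, `n ≠ 359`, n ∉ [11]; `B = 2^0·359^m`, `1 ≤ m < n`
(RULING H1 reduced exponents).
Residual of record R = {11} EXCLUDED in the statement (hres). Level 11488: every (orbit, exponent ≥ 11) pair killed in the kernel. Level 718 (tree): no residue ≥ 11.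
Row of record: `census/rows/C2a/C2a-l359-a0.md` (sha16 `d6b807e1c86698a1`; SIGNED 2026-08-22T17:51:55Z by referee (ref-g14)).
-/

namespace Summit.Ventures.AbcSig

/-- Row `C2aL359A0AB`: `a = 0`, second distribution `(359^m, 1)` — the first with `x, y` swapped (`IsPrimitiveSolution.swap`). -/
theorem xrow_C2aL359A0AB (M : NewformModel) (hP : M.BS04Package)
    (hD11488 : M.DataComplete 11488 level11488Orbits) (hCP11488 : M.RefinesCPSymAll 11488 level11488CP)
    (hD718 : M.DataComplete 718 level718Orbits)
    (n : ℕ) (hn : n.Prime) (hmin : 11 ≤ n) (hnℓ : n ≠ 359) (hres : n ∉ ([11] : List ℕ)) (m : ℕ) (hm : 1 ≤ m) (hmn : m < n)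
    (x y z : ℤ) (hxy1 : x * y ≠ 1) (hxy2 : x * y ≠ -1) : ¬ IsPrimitiveSolution (359 ^ m) (2 ^ 0) 1 n x y z := by
  intro h
  have h' : IsPrimitiveSolution 1 (2 ^ 0 * 359 ^ m) 1 n y x z := by simpa only [pow_zero, one_mul] using h.swap
  exact xrow_C2aL359A0 M hP  hD11488 hCP11488 hD718 n hn hmin hnℓ hres m hm hmn  y x z (by rwa [mul_comm]) (by rwa [mul_comm]) h'

end Summit.Ventures.AbcSig
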